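import Summits.ResolutionOfSingularities.ResolutionOfSingularities.Theorems.FrobeniusClosingPatchingRelPerfectDepthMultiHostCyl
import Literature.AlgebraicGeometry.Resolution.SmoothUniformizationProofs
import Literature.RingTheory.Flat.RegularFibreFlat
import HarnessLib

/-!
# Crux `PatchingRelPerfect` (stmt-ResolutionOfSingularities-16161), chain W5.2 — F7(β) d = 2 (β-AX), X2a module 2 (M2c), converse:
# PARAM-LIFT between regular stalks IS «flat with regular closed fibre» (Matsumura 23.1 / 23.7)

[OURS · L1 W5.2 · F7(β) (β-AX) X-side · res-D-pv-034 AS res-L1-s36-pv-3 per res-L1-w52-plan-1 RULING G11-21 ((M2c) PARAM-PROPAGATION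
KERNEL).]  Replaces the role of NO printed item; NOT a statement of the manuscript under review; fact-free, def-free.  AI-written; AI
review is weaker than expert review.  Companion of `…DepthParamLiftFlat.lean` (flat + regular fibre ⇒ `IsParamLiftAt`): here the
CONVERSE for regular stalks, through the tree's Matsumura 23.1 for a regular fibre
(`Literature.RingTheory.Flat.flat_of_isRegularLocalRing_of_isRegularLocalRing_fiber`).  Use (M2b / T2c / the e-chart propagation):
`cyl.param` makes the retraction `q` of a cylinder state FLAT with regular one-dimensional… fibres at every point of the cylinder
region (both stalks being regular), which is the input of every base-change argument on `q` (Rees algebra of the centre, blow-up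
charts).

## Contents
* `isRegularLocalRing_fiber_of_sup_span_eq` — ring form: `A → B` local, `A`, `B` regular, `𝔪_A B ⊔ (s) = 𝔪_B` with
  `#s + emb dim A = emb dim B` ⇒ the fibre `B/𝔪_A B` is regular, `dim A + dim (B/𝔪_A B) ≤ dim B`.
* **`flat_of_sup_span_eq`** — … hence `B` is flat over `A` (Matsumura 23.1, regular fibre).
* **`IsParamLiftAt.isRegularLocalRing_fiber`**, **`IsParamLiftAt.flat`** — the stalk forms for `q : V ⟶ Z` at `y` with
  `𝒪_{Z,q y}`, `𝒪_{V,y}` regular; `isParamLiftAt_iff_flat_and_isRegularLocalRing_fiber` (with the kernel's direction re-proved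
  inline, so that this file does not depend on the kernel file's build).

## References
* H. Matsumura, *Commutative Ring Theory* (1986), Thm. 15.1 (i), Thm. 23.1, Thm. 23.7. [Matsumura1987]
-/

-- `Summit.<Summit>.<Sub>.Theorems` with `Sub = Summit` (single-conjunct summit, D-0017)
set_option linter.dupNamespace false

noncomputable section

open CategoryTheory AlgebraicGeometry TopologicalSpace IsLocalRing
open Literature.AlgebraicGeometry.Resolution

namespace Summit.ResolutionOfSingularities.ResolutionOfSingularities.Theorems.DepthMultiHost

universe u

/-! ## §1 Ring form -/

section Ring

variable {A B : Type u} [CommRing A] [CommRing B] [IsRegularLocalRing A] [IsRegularLocalRing B] (f : A →+* B) [IsLocalHom f]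

/-- **PARAM-LIFT data force a regular fibre of the right dimension**: if `𝔪_A B ⊔ (s) = 𝔪_B` with `#s + emb dim A = emb dim B`
(`A`, `B` regular local, `f` local), then `B/𝔪_A B` is a regular local ring and `dim A + dim (B/𝔪_A B) ≤ dim B` (indeed `=`, by
Matsumura 15.1 (i) `dim B ≤ dim A + dim (B/𝔪_A B)`). [cite: Matsumura1987, Thm. 15.1 (i) and Thm. 23.7] -/
theorem isRegularLocalRing_fiber_of_sup_span_eq (s : Finset B)
    (hs1 : (maximalIdeal A).map f ⊔ Ideal.span (s : Set B) = maximalIdeal B)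
    (hs2 : s.card + (maximalIdeal A).spanFinrank = (maximalIdeal B).spanFinrank) :
    IsRegularLocalRing (B ⧸ (maximalIdeal A).map f) ∧
      ringKrullDim A + ringKrullDim (B ⧸ (maximalIdeal A).map f) ≤ ringKrullDim B := by
  classical
  letI := f.toAlgebra
  haveI : IsLocalHom (algebraMap A B) := ‹IsLocalHom f›
  set I : Ideal B := (maximalIdeal A).map f with hI
  have hIne : I ≠ ⊤ := map_maximalIdeal_ne_top (R := A) (S := B)
  haveI : Nontrivial (B ⧸ I) := Ideal.Quotient.nontrivial_iff.mpr hIne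
  haveI : IsLocalRing (B ⧸ I) := IsLocalRing.of_surjective' (Ideal.Quotient.mk I) Ideal.Quotient.mk_surjective
  set π : B →+* B ⧸ I := Ideal.Quotient.mk I with hπ
  -- the fibre's maximal ideal is generated by the images of `s`
  have hmF : maximalIdeal (B ⧸ I) = Ideal.span (π '' (s : Set B)) := by
    rw [maximalIdeal_quotient_eq_map I, ← hs1, Ideal.map_sup, Ideal.map_span,
      (Ideal.map_eq_bot_iff_le_ker π).mpr (by rw [hπ, Ideal.mk_ker]), bot_sup_eq]
  have hsfrF : (maximalIdeal (B ⧸ I)).spanFinrank ≤ s.card := by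
    rw [hmF]
    refine (Submodule.spanFinrank_span_le_ncard_of_finite ((s : Set B).toFinite.image π)).trans ?_
    rw [← Finset.coe_image]
    exact (Set.ncard_coe_finset _).le.trans Finset.card_image_le
  -- dimensions as natural numbers
  obtain ⟨dF, hdF⟩ := exists_ringKrullDim_eq_natCast (B ⧸ I)
  have hdA : ringKrullDim A = ((maximalIdeal A).spanFinrank : ℕ) := (IsRegularLocalRing.spanFinrank_maximalIdeal (R := A)).symm
  have hdB : ringKrullDim B = ((maximalIdeal B).spanFinrank : ℕ) := (IsRegularLocalRing.spanFinrank_maximalIdeal (R := B)).symm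
  -- Krull: `dim F ≤ emb dim F ≤ #s`
  have hF1 : dF ≤ s.card := by
    have h := ringKrullDim_le_spanFinrank_maximalIdeal (B ⧸ I)
    rw [hdF] at h
    have h' : dF ≤ (maximalIdeal (B ⧸ I)).spanFinrank := by exact_mod_cast h
    exact h'.trans hsfrF
  -- Matsumura 15.1 (i): `dim B ≤ dim A + dim F`
  have hF2 : (maximalIdeal B).spanFinrank ≤ (maximalIdeal A).spanFinrank + dF := by
    haveI : (maximalIdeal B).LiesOver (maximalIdeal A) := ⟨(maximalIdeal_comap (algebraMap A B)).symm⟩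
    have h := Ideal.height_le_height_add_of_liesOver (maximalIdeal A) (maximalIdeal B)
    rw [← maximalIdeal_quotient_eq_map ((maximalIdeal A).map (algebraMap A B))] at h
    have h' : ((maximalIdeal B).height : WithBot ℕ∞) ≤
        (maximalIdeal A).height + (maximalIdeal (B ⧸ (maximalIdeal A).map (algebraMap A B))).height := by
      exact_mod_cast h
    rw [maximalIdeal_height_eq_ringKrullDim, maximalIdeal_height_eq_ringKrullDim, maximalIdeal_height_eq_ringKrullDim,
      hdA, hdB, show (maximalIdeal A).map (algebraMap A B) = I from rfl, hdF] at h'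
    exact_mod_cast h'
  have hdFeq : dF = s.card := by omega
  refine ⟨IsRegularLocalRing.of_spanFinrank_maximalIdeal_le _ ?_, ?_⟩
  · rw [hdF]; exact_mod_cast (hdFeq ▸ hsfrF)
  · rw [hdA, hdB, hdF, hdFeq, ← hs2, add_comm s.card]
    push_cast; exact le_rfl

/-- **Matsumura 23.1 (regular fibre) from PARAM-LIFT data**: under the same hypotheses `B` is FLAT over `A`.
[cite: Matsumura1987, Thm. 23.1] -/
theorem flat_of_sup_span_eq (s : Finset B) (hs1 : (maximalIdeal A).map f ⊔ Ideal.span (s : Set B) = maximalIdeal B)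
    (hs2 : s.card + (maximalIdeal A).spanFinrank = (maximalIdeal B).spanFinrank) : f.Flat := by
  letI := f.toAlgebra
  haveI : IsLocalHom (algebraMap A B) := ‹IsLocalHom f›
  obtain ⟨hF, hdim⟩ := isRegularLocalRing_fiber_of_sup_span_eq f s hs1 hs2
  exact Literature.RingTheory.Flat.flat_of_isRegularLocalRing_of_isRegularLocalRing_fiber hF hdim

end Ring

/-! ## §2 Stalk form -/

section Stalk

variable {V Z : Scheme.{u}} (q : V ⟶ Z) (y : V)

/-- [OURS · L1 W5.2 · F7(β) (β-AX) M2c] **PARAM-LIFT ⇒ regular closed fibre** (regular stalks). [cite: Matsumura1987, Thm. 23.7] -/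
theorem IsParamLiftAt.isRegularLocalRing_fiber [IsRegularLocalRing (Z.presheaf.stalk (q y))]
    [IsRegularLocalRing (V.presheaf.stalk y)] (h : IsParamLiftAt q y) :
    IsRegularLocalRing (V.presheaf.stalk y ⧸ (maximalIdeal (Z.presheaf.stalk (q y))).map (q.stalkMap y).hom) := by
  obtain ⟨s, hs1, hs2⟩ := h
  exact (isRegularLocalRing_fiber_of_sup_span_eq (q.stalkMap y).hom s hs1 hs2).1

/-- [OURS · L1 W5.2 · F7(β) (β-AX) M2c] **PARAM-LIFT ⇒ FLAT** (regular stalks; Matsumura 23.1 for a regular fibre).  With `cyl.param`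
this makes the retraction of a cylinder state flat at every point of the cylinder region. [cite: Matsumura1987, Thm. 23.1] -/
theorem IsParamLiftAt.flat [IsRegularLocalRing (Z.presheaf.stalk (q y))] [IsRegularLocalRing (V.presheaf.stalk y)]
    (h : IsParamLiftAt q y) : (q.stalkMap y).hom.Flat := by
  obtain ⟨s, hs1, hs2⟩ := h
  exact flat_of_sup_span_eq (q.stalkMap y).hom s hs1 hs2

/-- [OURS · L1 W5.2 · F7(β) (β-AX) M2c] **PARAM-LIFT ⟺ flat with regular closed fibre**, for regular stalks (the `←` direction is
the kernel of `…DepthParamLiftFlat.lean`, re-proved here from the tree's `spanFinrank_maximalIdeal_eq_add`).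
[cite: Matsumura1987, Thm. 23.1 and Thm. 23.7] -/
theorem isParamLiftAt_iff_flat_and_isRegularLocalRing_fiber [IsRegularLocalRing (Z.presheaf.stalk (q y))]
    [IsRegularLocalRing (V.presheaf.stalk y)] :
    IsParamLiftAt q y ↔ (q.stalkMap y).hom.Flat ∧
      IsRegularLocalRing (V.presheaf.stalk y ⧸ (maximalIdeal (Z.presheaf.stalk (q y))).map (q.stalkMap y).hom) := by
  classical
  refine ⟨fun h => ⟨h.flat, h.isRegularLocalRing_fiber⟩, fun ⟨hflat, hfib⟩ => ?_⟩
  -- flat + regular fibre ⇒ PARAM-LIFT (as in the kernel file)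
  set f := (q.stalkMap y).hom with hf
  letI := f.toAlgebra
  haveI : IsLocalHom (algebraMap (Z.presheaf.stalk (q y)) (V.presheaf.stalk y)) := inferInstanceAs (IsLocalHom f)
  haveI : Module.Flat (Z.presheaf.stalk (q y)) (V.presheaf.stalk y) := hflat
  haveI hfib' : IsRegularLocalRing (V.presheaf.stalk y ⧸ (maximalIdeal (Z.presheaf.stalk (q y))).map
      (algebraMap (Z.presheaf.stalk (q y)) (V.presheaf.stalk y))) := hfib
  set I := (maximalIdeal (Z.presheaf.stalk (q y))).map (algebraMap (Z.presheaf.stalk (q y)) (V.presheaf.stalk y)) with hI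
  set π := Ideal.Quotient.mk I with hπ
  have hπs : Function.Surjective π := Ideal.Quotient.mk_surjective
  haveI := IsLocalHom.of_surjective π hπs
  have hadd := spanFinrank_maximalIdeal_eq_add (R := Z.presheaf.stalk (q y)) (S := V.presheaf.stalk y)
  obtain ⟨s₀, hs₀card, hs₀span⟩ := Submodule.FG.exists_span_finset_card_eq_spanFinrank (maximalIdeal (_ ⧸ I)).fg_of_isNoetherianRing
  choose g hg using fun x : _ ⧸ I => hπs x
  refine ⟨s₀.image g, ?_, ?_⟩
  · apply le_antisymm
    · refine sup_le (map_maximalIdeal_le _) ?_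
      rw [Ideal.span_le]
      intro b hb
      obtain ⟨x, hx, rfl⟩ := Finset.mem_image.mp (Finset.mem_coe.mp hb)
      have hxm : (x : _ ⧸ I) ∈ maximalIdeal (_ ⧸ I) := by
        rw [← hs₀span]; exact Submodule.subset_span (Finset.mem_coe.mpr hx)
      exact (map_mem_nonunits_iff π (g x)).mp (by rw [hg]; exact hxm)
    · intro b hb
      have hπb : π b ∈ Ideal.span (s₀ : Set (_ ⧸ I)) := by
        rw [show Ideal.span (s₀ : Set (_ ⧸ I)) = maximalIdeal (_ ⧸ I) from hs₀span]
        exact map_nonunit π b hb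
      have hs₀g : (s₀ : Set (_ ⧸ I)) = π '' ((s₀.image g : Finset _) : Set _) := by
        rw [Finset.coe_image, Set.image_image]
        ext x; simp [hg]
      rw [hs₀g, ← Ideal.map_span, Ideal.mem_map_iff_of_surjective π hπs] at hπb
      obtain ⟨c, hc, hcb⟩ := hπb
      have hbc : b - c ∈ I := by
        rw [← Ideal.Quotient.eq, ← hπ]; exact hcb.symm
      have : b = (b - c) + c := by ring
      rw [this]
      exact Ideal.add_mem _ (Ideal.mem_sup_left hbc) (Ideal.mem_sup_right hc)
  · have hinj : Set.InjOn g (s₀ : Set (_ ⧸ I)) := fun x _ y _ hxy => by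
      rw [← hg x, ← hg y, hxy]
    rw [Finset.card_image_of_injOn hinj, hs₀card, hadd, add_comm]

end Stalk

end Summit.ResolutionOfSingularities.ResolutionOfSingularities.Theorems.DepthMultiHost

end
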